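import Summits.CriticalPhenomena.PercolationContinuityZ3.Theorems.Transplant.FKConnectivityAllQSPMono
import Summits.CriticalPhenomena.PercolationContinuityZ3.Theorems.Transplant.FKConnectivityAllQEdgeLocal
import HarnessLib

/-!
# Connectivity correlation inequalities for `φ_{w,q}`, every `q > 0` — file 13: WAGNER'S THEOREM for two-terminal series–parallel
# networks — EC⁺, pairwise positive correlation of connections and the hub inequality for EVERY `q > 0`, edge-negative association
# for `q < 1`, all UNCONDITIONAL on the class `FK.IsTTSP`

Support file (`--supports stmt-CriticalPhenomena-4575`), FK sub-lane `prim-bschramm-fk-2` (gen 7) of the post-continuity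
programme; builds on p205010 (kernel theorem, internal audit signed; external expert review pending).  No definitions, no named
facts, no sorries; standard axioms.

Let `E` be a two-terminal series–parallel network with terminals `x, y` (`FK.IsTTSP E x y`, `…AllQSPDefs.lean`) and let the
weight vector `w` be supported in `E`.  For the random-cluster measure `φ_{w,q} = rcMeasureW w q ∅` (Grimmett 2006, (1.20)):
* **`FK.edgeConnMono_of_isTTSP`** (every `q > 0`): `φ_{w[f↦0],q}(x ↔ y) ≤ φ_{w[f↦1],q}(x ↔ y)` for every pair `f` with
  `0 < w f < 1` — EC⁺ for the terminals, from Wagner's induction `FK.spMono_of_isTTSP` (`C⁰D¹ ≤ C¹D⁰`) and the one-pair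
  decompositions of `…AllQEdgeMono/EdgeToggle.lean`; **`FK.rcMeasureW_real_openConn_mono_of_isTTSP`**: hence `φ_{w,q}(x ↔ y)` is
  non-decreasing in every edge parameter along weight vectors supported in `E` (every `q > 0`).
* **`FK.pairConnPosUnder_of_isTTSP`** (every `q > 0`): if `E` is a two-terminal series–parallel network both between `x, y` and
  between `u, v`, then `φ(x ↔ y)·φ(u ↔ v) ≤ φ(x ↔ y, u ↔ v)` (the support-restricted Bernstein induction
  `FK.pairConn_mass_le_of_edgeConnMono_on`); **`FK.hubUnder_of_isTTSP`**: Ayyer–Linusson–Ravichandran's hub inequality (13),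
  `φ(o ↔ a)·φ(b ↔ a) ≤ φ(o ↔ a ↔ b)`, whenever `E` is two-terminal series–parallel between `o, a` and between `b, a`.
* **`FK.edgeNegCorr_of_isTTSP`** (`0 < q < 1`): `φ(J_{xy} ∩ J_f) ≤ φ(J_{xy})·φ(J_f)` for every pair `f ≠ xy` — Wagner's theorem
  (2008, graph case of Ex. 5.1 + Thm. 5.8(d): series–parallel graphs are Potts–Rayleigh for all `0 < q ≤ 1`) in Grimmett's
  negative-correlation form (§3.9 eq. (3.94)), for the pair `xy` of terminals, via the master identity `FK.negCorr_defect_eq`;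
  `FK.edgeNegCorr_of_isTTSP_of_le_one`: Wagner's full range `0 < q ≤ 1` (equality at `q = 1`, product measure).
For a 2-connected series–parallel graph `G` and any edge `xy ∈ G`, `G` is a two-terminal series–parallel network between `x` and
`y` (Duffin 1965), so on paper these are EC⁺ / Rayleigh for ALL pairs of edges of every series–parallel weighted graph; the Lean
statements take the two-terminal structure `IsTTSP E x y` for the pair at hand as the hypothesis (Duffin's structure theorem is not
in the tree).  The sibling `…AllQSeriesParallel.lean` derives the hub inequality on all `K₄`-minor-free supports from the NAMED FACT
`Wagner2008_rc_edgeNegCorr_of_noK4Minor`; the present file needs no named fact.  Small constructors for the class (`IsTTSP.symm`,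
`IsTTSP.insert_edge` — the terminal edge in parallel —, `IsTTSP.path₂`, `IsTTSP.triangle`) close the file.
[cite: Wagner2006, Ex. 5.1, Thm. 5.8(d), §5.3] [cite: Grimmett2006, §3.9 eq. (3.94) (pp. 63–64); Thm. (3.1)(a) (p. 37); §1.4 eq. (1.20)]
[cite: AyyerLinussonRavichandran2025, §7 eq. (13)–(15), Conj. 7.1, Thm. 5.3 (p. 22)]
-/

noncomputable section

namespace Summit.CriticalPhenomena.PercolationContinuityZ3.Theorems

namespace FK

open MeasureTheory Set SimpleGraph Literature.Probability.LatticeModels Literature.Probability.Percolation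
open Literature.Probability.Percolation.DecisionTree (ind ind_of_mem ind_of_not_mem ind_nonneg)
open scoped Classical

variable {V : Type*} [Fintype V]

/-! ### EC⁺ for the terminals of a two-terminal series–parallel network, every `q > 0` -/

/-- **EC⁺ on two-terminal series–parallel networks, every `q > 0`**: if `E` is a two-terminal series–parallel network between
`x` and `y` and `w` is supported in `E`, then for every pair `f` with `0 < w f < 1`,
`φ_{w[f↦0],q}(x ↔ y) ≤ φ_{w[f↦1],q}(x ↔ y)`. [cite: Wagner2006, Thm. 5.8(d), §5.3] [cite: Grimmett2006, Thm. (3.1)(a) (p. 37); §3.9 (p. 63)] -/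
theorem edgeConnMono_of_isTTSP {q : ℝ} (hq : 0 < q) {E : Finset (Sym2 V)} {x y : V} (hE : IsTTSP E x y)
    (w : Sym2 V → unitInterval) (hw : ∀ e, ((w e : unitInterval) : ℝ) ≠ 0 → e ∈ (↑E : Set (Sym2 V))) (f : Sym2 V)
    (hf0 : 0 < ((w f : unitInterval) : ℝ)) (hf1 : ((w f : unitInterval) : ℝ) < 1) :
    (rcMeasureW (Function.update w f 0) q ∅).real (openConn x y) ≤
      (rcMeasureW (Function.update w f 1) q ∅).real (openConn x y) := by
  rw [real_le_real_iff_mass hq]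
  have hmono := spMono_of_isTTSP w hq hE f
  have hS : ∀ A : Set (BondConfig V), netMass w q (↑E : Set (Sym2 V)) A = ∑ ω : BondConfig V, rcWeightW w q ∅ ω * ind A ω :=
    fun A => (sum_rcWeightW_ind_eq_netMass w q hw A).symm
  -- the four marked masses in terms of the pinned measures
  have eC1 : netMass w q (↑E : Set (Sym2 V)) (openConn x y ∩ {η | f ∈ η}) =
      (w f : ℝ) * ∑ ω : BondConfig V, rcWeightW (Function.update w f 1) q ∅ ω * ind (openConn x y) ω := by
    rw [hS, Set.inter_comm (openConn x y) {η | f ∈ η}, sum_rcWeightW_ind_inter_openPair]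
  have eC0 : netMass w q (↑E : Set (Sym2 V)) (openConn x y ∩ {η | f ∈ η}ᶜ) =
      (1 - (w f : ℝ)) * ∑ ω : BondConfig V, rcWeightW (Function.update w f 0) q ∅ ω * ind (openConn x y) ω := by
    rw [hS, sum_rcWeightW_ind_inter_compl w q (openConn x y) {η | f ∈ η}, sum_rcWeightW_ind_affine w q f (openConn x y),
      Set.inter_comm (openConn x y) {η | f ∈ η}, sum_rcWeightW_ind_inter_openPair]
    ring
  have eD1 : netMass w q (↑E : Set (Sym2 V)) ((openConn x y)ᶜ ∩ {η | f ∈ η}) =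
      (w f : ℝ) * (rcPartitionFunctionW (Function.update w f 1) q ∅ -
        ∑ ω : BondConfig V, rcWeightW (Function.update w f 1) q ∅ ω * ind (openConn x y) ω) := by
    rw [hS, Set.inter_comm (openConn x y)ᶜ {η | f ∈ η}, sum_rcWeightW_ind_inter_openPair, sum_rcWeightW_ind_compl]
  have eD0 : netMass w q (↑E : Set (Sym2 V)) ((openConn x y)ᶜ ∩ {η | f ∈ η}ᶜ) =
      (1 - (w f : ℝ)) * (rcPartitionFunctionW (Function.update w f 0) q ∅ -
        ∑ ω : BondConfig V, rcWeightW (Function.update w f 0) q ∅ ω * ind (openConn x y) ω) := by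
    rw [hS, sum_rcWeightW_ind_inter_compl w q (openConn x y)ᶜ {η | f ∈ η}, sum_rcWeightW_ind_affine w q f (openConn x y)ᶜ,
      Set.inter_comm (openConn x y)ᶜ {η | f ∈ η}, sum_rcWeightW_ind_inter_openPair, sum_rcWeightW_ind_compl,
      sum_rcWeightW_ind_compl]
    ring
  rw [eC1, eC0, eD1, eD0] at hmono
  have hcc : 0 < (w f : ℝ) * (1 - (w f : ℝ)) := mul_pos hf0 (by linarith)
  have key : (w f : ℝ) * (1 - (w f : ℝ)) *
      ((∑ ω : BondConfig V, rcWeightW (Function.update w f 0) q ∅ ω * ind (openConn x y) ω) *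
        rcPartitionFunctionW (Function.update w f 1) q ∅) ≤
      (w f : ℝ) * (1 - (w f : ℝ)) *
      ((∑ ω : BondConfig V, rcWeightW (Function.update w f 1) q ∅ ω * ind (openConn x y) ω) *
        rcPartitionFunctionW (Function.update w f 0) q ∅) := by
    nlinarith [hmono]
  exact le_of_mul_le_mul_left key hcc

/-! ### Monotonicity of the terminal connection probability in all the parameters, every `q > 0` -/

/-- One coordinate: the connection probability is a ratio of affine functions of `w e`, monotone as soon as
`S_{w[e↦0]}(x↔y)·Z_{w[e↦1]} ≤ S_{w[e↦1]}(x↔y)·Z_{w[e↦0]}` (the proof of `FK.rcMeasureW_real_openConn_mono_update` with the EC⁺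
instance as a hypothesis). [cite: Grimmett2006, Thm. (3.21) (p. 43); §3.9 (p. 63)] -/
theorem rcMeasureW_real_openConn_mono_update_of_mass {q : ℝ} (hq : 0 < q) (w : Sym2 V → unitInterval) (e : Sym2 V) (x y : V)
    {c c' : unitInterval} (hcc : c ≤ c')
    (hL : (∑ ω : BondConfig V, rcWeightW (Function.update w e 0) q ∅ ω * ind (openConn x y) ω) *
        rcPartitionFunctionW (Function.update w e 1) q ∅ ≤
      (∑ ω : BondConfig V, rcWeightW (Function.update w e 1) q ∅ ω * ind (openConn x y) ω) *
        rcPartitionFunctionW (Function.update w e 0) q ∅) :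
    (rcMeasureW (Function.update w e c) q ∅).real (openConn x y) ≤
      (rcMeasureW (Function.update w e c') q ∅).real (openConn x y) := by
  rw [real_le_real_iff_mass hq]
  have sA : ∀ d : unitInterval, ∑ ω : BondConfig V, rcWeightW (Function.update w e d) q ∅ ω * ind (openConn x y) ω =
      (1 - (d : ℝ)) * ∑ ω : BondConfig V, rcWeightW (Function.update w e 0) q ∅ ω * ind (openConn x y) ω +
        (d : ℝ) * ∑ ω : BondConfig V, rcWeightW (Function.update w e 1) q ∅ ω * ind (openConn x y) ω := by
    intro d
    have h := sum_rcWeightW_ind_affine (Function.update w e d) q e (openConn x y)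
    simp only [Function.update_idem, Function.update_self] at h
    exact h
  have sZ : ∀ d : unitInterval, rcPartitionFunctionW (Function.update w e d) q ∅ =
      (1 - (d : ℝ)) * rcPartitionFunctionW (Function.update w e 0) q ∅ +
        (d : ℝ) * rcPartitionFunctionW (Function.update w e 1) q ∅ := by
    intro d
    have h := rcPartitionFunctionW_affine (Function.update w e d) q e
    simp only [Function.update_idem, Function.update_self] at h
    exact h
  rw [sA c, sA c', sZ c, sZ c']
  have hcc' : (c : ℝ) ≤ (c' : ℝ) := hcc
  have hc0 : 0 ≤ (c : ℝ) := c.2.1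
  have hc1 : (c' : ℝ) ≤ 1 := c'.2.2
  nlinarith [hL, hcc', hc0, hc1]

/-- **On a two-terminal series–parallel support the terminal connection probability is non-decreasing in every edge parameter,
for every `q > 0`**: if `E` is two-terminal series–parallel between `x` and `y`, `w ≤ w'` pointwise and `w'` is supported in `E`,
then `φ_{w,q}(x ↔ y) ≤ φ_{w',q}(x ↔ y)`.  (For `q ≥ 1` this is Grimmett's comparison inequality (3.21) on every graph; for `q < 1`
it is the monotonicity missing in general, §3.9 / §5.8.) [cite: Wagner2006, Thm. 5.8(d), §5.3] [cite: Grimmett2006, Thm. (3.21) (p. 43); §3.9 (p. 63); §5.8 (p. 131)] -/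
theorem rcMeasureW_real_openConn_mono_of_isTTSP {q : ℝ} (hq : 0 < q) {E : Finset (Sym2 V)} {x y : V} (hE : IsTTSP E x y)
    {w w' : Sym2 V → unitInterval} (hww : ∀ e, w e ≤ w' e)
    (hw' : ∀ e, ((w' e : unitInterval) : ℝ) ≠ 0 → e ∈ (↑E : Set (Sym2 V))) :
    (rcMeasureW w q ∅).real (openConn x y) ≤ (rcMeasureW w' q ∅).real (openConn x y) := by
  -- one fractional pinning gives the mass inequality at any vector dominated by `w'`
  have step : ∀ u : Sym2 V → unitInterval, (∀ g, u g ≤ w' g) → ∀ e : Sym2 V, e ∈ (↑E : Set (Sym2 V)) →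
      (∑ ω : BondConfig V, rcWeightW (Function.update u e 0) q ∅ ω * ind (openConn x y) ω) *
          rcPartitionFunctionW (Function.update u e 1) q ∅ ≤
        (∑ ω : BondConfig V, rcWeightW (Function.update u e 1) q ∅ ω * ind (openConn x y) ω) *
          rcPartitionFunctionW (Function.update u e 0) q ∅ := by
    intro u hu e he
    set half : unitInterval := ⟨2⁻¹, by norm_num, by norm_num⟩ with hhalf
    have hsupp : ∀ g, ((Function.update u e half g : unitInterval) : ℝ) ≠ 0 → g ∈ (↑E : Set (Sym2 V)) := by
      intro g hg
      by_cases hge : g = e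
      · subst hge; exact he
      · rw [Function.update_of_ne hge] at hg
        refine hw' g fun h0 => hg (le_antisymm ?_ (u g).2.1)
        calc ((u g : unitInterval) : ℝ) ≤ ((w' g : unitInterval) : ℝ) := hu g
          _ = 0 := h0
    have h := edgeConnMono_of_isTTSP hq hE (Function.update u e half) hsupp e
      (by rw [Function.update_self]; norm_num [hhalf]) (by rw [Function.update_self]; norm_num [hhalf])
    rw [Function.update_idem, Function.update_idem, real_le_real_iff_mass hq] at h
    exact h
  -- change the coordinates one at a time along an enumeration of the pairs
  suffices h : ∀ (s : Finset (Sym2 V)) (u : Sym2 V → unitInterval), (∀ e, u e ≤ w' e) → (∀ e ∉ s, u e = w' e) →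
      (rcMeasureW u q ∅).real (openConn x y) ≤ (rcMeasureW w' q ∅).real (openConn x y) from
    h Finset.univ w hww (fun e he => absurd (Finset.mem_univ e) he)
  intro s
  induction s using Finset.induction_on with
  | empty =>
    intro u _ heq
    have : u = w' := funext fun e => heq e (Finset.notMem_empty e)
    rw [this]
  | @insert e s hes ih =>
    intro u hu heq
    -- intermediate vector: `u` with the coordinate `e` raised to `w' e`
    have h1 : (rcMeasureW u q ∅).real (openConn x y) ≤ (rcMeasureW (Function.update u e (w' e)) q ∅).real (openConn x y) := by
      by_cases hue : u e = w' e
      · rw [← hue, Function.update_eq_self]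
      · have hpos : ((w' e : unitInterval) : ℝ) ≠ 0 := by
          intro h0
          apply hue
          exact le_antisymm (hu e) (by
            change ((w' e : unitInterval) : ℝ) ≤ ((u e : unitInterval) : ℝ)
            rw [h0]; exact (u e).2.1)
        have h := rcMeasureW_real_openConn_mono_update_of_mass hq u e x y (hu e) (step u hu e (hw' e hpos))
        rw [Function.update_eq_self] at h
        exact h
    have h2 : (rcMeasureW (Function.update u e (w' e)) q ∅).real (openConn x y) ≤ (rcMeasureW w' q ∅).real (openConn x y) := by
      refine ih (Function.update u e (w' e)) (fun f => ?_) (fun f hf => ?_)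
      · by_cases hfe : f = e
        · subst hfe; rw [Function.update_self]
        · rw [Function.update_of_ne hfe]; exact hu f
      · by_cases hfe : f = e
        · subst hfe; rw [Function.update_self]
        · rw [Function.update_of_ne hfe]
          exact heq f (fun h => (Finset.mem_insert.1 h).elim hfe hf)
    exact h1.trans h2

/-! ### Pairwise positive correlation of connection events and the hub inequality, every `q > 0` -/

/-- **Pairwise positive correlation of two-point connection events on two-terminal series–parallel supports, every `q > 0`**:
if the support network `E ⊇ supp(w)` is two-terminal series–parallel both between `x, y` and between `u, v`, then
`φ_{w,q}(x ↔ y)·φ_{w,q}(u ↔ v) ≤ φ_{w,q}(x ↔ y, u ↔ v)`.  UNCONDITIONAL (compare `FK.pairConnPosUnder_of_noK4Minor`, conditional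
on the named fact `Wagner2008_rc_edgeNegCorr_of_noK4Minor`). [cite: AyyerLinussonRavichandran2025, §7 eq. (13)–(15) (p. 22)] [cite: Wagner2006, Thm. 5.8(d), §5.3] -/
theorem pairConnPosUnder_of_isTTSP {q : ℝ} (hq : 0 < q) {E : Finset (Sym2 V)} {x y u v : V} (hxy : IsTTSP E x y)
    (huv : IsTTSP E u v) (w : Sym2 V → unitInterval) (hw : ∀ e, ((w e : unitInterval) : ℝ) ≠ 0 → e ∈ (↑E : Set (Sym2 V))) :
    PairConnPosUnder (rcMeasureW w q ∅) x y u v := by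
  have hmass := pairConn_mass_le_of_edgeConnMono_on hq (↑E : Set (Sym2 V)) x y u v
    (fun w' hw' e he0 he1 => edgeConnMono_of_isTTSP hq hxy w' hw' e he0 he1)
    (fun w' hw' e he0 he1 => edgeConnMono_of_isTTSP hq huv w' hw' e he0 he1) w hw
  haveI := isProbabilityMeasure_rcMeasureW w hq (∅ : Set V)
  unfold PairConnPosUnder
  rw [probReal_univ, one_mul, rcMeasureW_real_eq_sum_div w hq ∅ (openConn x y), rcMeasureW_real_eq_sum_div w hq ∅ (openConn u v),
    rcMeasureW_real_eq_sum_div w hq ∅ (openConn x y ∩ openConn u v)]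
  have hZ := rcPartitionFunctionW_pos w hq (∅ : Set V)
  rw [div_mul_div_comm, div_le_div_iff₀ (mul_pos hZ hZ) hZ]
  calc (∑ ω : BondConfig V, rcWeightW w q ∅ ω * ind (openConn x y) ω) *
          (∑ ω : BondConfig V, rcWeightW w q ∅ ω * ind (openConn u v) ω) * rcPartitionFunctionW w q ∅
      ≤ (rcPartitionFunctionW w q ∅ * ∑ ω : BondConfig V, rcWeightW w q ∅ ω * ind (openConn x y ∩ openConn u v) ω) *
          rcPartitionFunctionW w q ∅ := mul_le_mul_of_nonneg_right hmass hZ.le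
    _ = (∑ ω : BondConfig V, rcWeightW w q ∅ ω * ind (openConn x y ∩ openConn u v) ω) *
          (rcPartitionFunctionW w q ∅ * rcPartitionFunctionW w q ∅) := by ring

/-- **The hub inequality on two-terminal series–parallel supports, every `q > 0`** (Ayyer–Linusson–Ravichandran 2025 (13)):
if `E ⊇ supp(w)` is two-terminal series–parallel between `o, a` and between `b, a`, then `φ_{w,q}(o ↔ a)·φ_{w,q}(b ↔ a) ≤ φ_{w,q}(o ↔ a ↔ b)`.
UNCONDITIONAL. [cite: AyyerLinussonRavichandran2025, §7 eq. (13), Conj. 7.1, Thm. 5.3 (p. 22)] [cite: Wagner2006, Thm. 5.8(d), §5.3] -/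
theorem hubUnder_of_isTTSP {q : ℝ} (hq : 0 < q) {E : Finset (Sym2 V)} {o a b : V} (hoa : IsTTSP E o a) (hba : IsTTSP E b a)
    (w : Sym2 V → unitInterval) (hw : ∀ e, ((w e : unitInterval) : ℝ) ≠ 0 → e ∈ (↑E : Set (Sym2 V))) :
    HubUnder (rcMeasureW w q ∅) o a b :=
  hubUnder_of_pairConnPosUnder _ o a b (pairConnPosUnder_of_isTTSP hq hoa hba w hw)

/-! ### Wagner's theorem: edge-negative association for `0 < q < 1` -/

/-- **Wagner's theorem for two-terminal series–parallel networks (negative-correlation form), `0 < q < 1`**: if `E` is a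
two-terminal series–parallel network between `x` and `y` and `w` is supported in `E`, then the pair `xy` is negatively correlated
with every other pair under `φ_{w,q}`: `φ(J_{xy} ∩ J_f) ≤ φ(J_{xy})·φ(J_f)` (`J_e = {ω | e ∈ ω}`).  Via the master identity
`FK.negCorr_defect_eq` and EC⁺ in the state `w[xy ↦ 0]`.  UNCONDITIONAL; for 2-connected series–parallel graphs and any edge `xy`
the hypothesis holds by Duffin's theorem (not in the tree). [cite: Wagner2006, Ex. 5.1, Thm. 5.8(d), §5.3] [cite: Grimmett2006, §3.9 eq. (3.94) (pp. 63–64)] -/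
theorem edgeNegCorr_of_isTTSP {q : ℝ} (hq0 : 0 < q) (hq1 : q < 1) {E : Finset (Sym2 V)} {x y : V} (hE : IsTTSP E x y)
    (w : Sym2 V → unitInterval) (hw : ∀ e, ((w e : unitInterval) : ℝ) ≠ 0 → e ∈ (↑E : Set (Sym2 V))) (f : Sym2 V)
    (hfe : f ≠ s(x, y)) :
    (rcMeasureW w q ∅).real ({ω | s(x, y) ∈ ω} ∩ {ω | f ∈ ω}) ≤
      (rcMeasureW w q ∅).real {ω | s(x, y) ∈ ω} * (rcMeasureW w q ∅).real {ω | f ∈ ω} := by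
  have hZ := rcPartitionFunctionW_pos w hq0 (∅ : Set V)
  rw [rcMeasureW_real_eq_sum_div w hq0 ∅, rcMeasureW_real_eq_sum_div w hq0 ∅, rcMeasureW_real_eq_sum_div w hq0 ∅,
    div_mul_div_comm, div_le_div_iff₀ hZ (mul_pos hZ hZ)]
  -- it suffices that the defect is `≤ 0`
  suffices hdef : (∑ ω : BondConfig V, rcWeightW w q ∅ ω * ind ({ω | s(x, y) ∈ ω} ∩ {ω | f ∈ ω}) ω) *
      rcPartitionFunctionW w q ∅ -
      (∑ ω : BondConfig V, rcWeightW w q ∅ ω * ind {ω | s(x, y) ∈ ω} ω) *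
        (∑ ω : BondConfig V, rcWeightW w q ∅ ω * ind {ω | f ∈ ω} ω) ≤ 0 by
    have h2 := mul_le_mul_of_nonneg_right hdef hZ.le
    linarith [h2]
  rw [negCorr_defect_eq w hq0.ne' x y hfe]
  have hc0 : 0 ≤ ((w s(x, y) : unitInterval) : ℝ) := (w s(x, y)).2.1
  have hc1 : ((w s(x, y) : unitInterval) : ℝ) ≤ 1 := (w s(x, y)).2.2
  have hd0 : 0 ≤ ((w f : unitInterval) : ℝ) := (w f).2.1
  have hd1 : ((w f : unitInterval) : ℝ) ≤ 1 := (w f).2.2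
  have hr : 0 ≤ q⁻¹ - 1 := by rw [sub_nonneg]; exact (one_lt_inv_iff₀.2 ⟨hq0, hq1⟩).le
  by_cases hfrac : 0 < ((w f : unitInterval) : ℝ) ∧ ((w f : unitInterval) : ℝ) < 1
  · -- EC⁺ for the terminals in the state `w[xy ↦ 0]`, at the fractional pair `f`
    have hw' : ∀ g, ((Function.update w s(x, y) 0 g : unitInterval) : ℝ) ≠ 0 → g ∈ (↑E : Set (Sym2 V)) := by
      intro g hg
      by_cases hge : g = s(x, y)
      · subst hge
        rw [Function.update_self] at hg
        exact absurd rfl hg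
      · rw [Function.update_of_ne hge] at hg
        exact hw g hg
    have hf' : ((Function.update w s(x, y) 0 f : unitInterval) : ℝ) = ((w f : unitInterval) : ℝ) := by
      rw [Function.update_of_ne hfe]
    have hEC := edgeConnMono_of_isTTSP hq0 hE (Function.update w s(x, y) 0) hw' f (by rw [hf']; exact hfrac.1)
      (by rw [hf']; exact hfrac.2)
    have hEC' := (edgeConnMono_iff_compl_mass hq0 x y).1 hEC
    have hfac : 0 ≤ ((w s(x, y) : unitInterval) : ℝ) * (1 - ((w s(x, y) : unitInterval) : ℝ)) *
        (((w f : unitInterval) : ℝ) * (1 - ((w f : unitInterval) : ℝ))) * (q⁻¹ - 1) := by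
      have h1 : 0 ≤ 1 - ((w s(x, y) : unitInterval) : ℝ) := by linarith
      have h2 : 0 ≤ 1 - ((w f : unitInterval) : ℝ) := by linarith
      positivity
    exact mul_nonpos_iff.2 (Or.inl ⟨hfac, by linarith⟩)
  · -- `w f ∈ {0, 1}`: the prefactor `d(1 − d)` vanishes
    have hd : ((w f : unitInterval) : ℝ) * (1 - ((w f : unitInterval) : ℝ)) = 0 := by
      rcases not_and_or.1 hfrac with h | h
      · have h0 : ((w f : unitInterval) : ℝ) = 0 := le_antisymm (not_lt.1 h) hd0
        rw [h0]; ring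
      · have h1 : ((w f : unitInterval) : ℝ) = 1 := le_antisymm hd1 (not_lt.1 h)
        rw [h1]; ring
    rw [hd, mul_zero, zero_mul, zero_mul]

/-- **Wagner's range `0 < q ≤ 1`**: the same conclusion with `q = 1` included (at `q = 1` the measure is the product measure
`prodBernoulli w` and distinct pairs are independent, so equality holds). [cite: Wagner2006, Ex. 5.1, Thm. 5.8(d), §5.3] [cite: Grimmett2006, §3.9 eq. (3.94) (pp. 63–64); §1.3] -/
theorem edgeNegCorr_of_isTTSP_of_le_one {q : ℝ} (hq0 : 0 < q) (hq1 : q ≤ 1) {E : Finset (Sym2 V)} {x y : V}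
    (hE : IsTTSP E x y) (w : Sym2 V → unitInterval) (hw : ∀ e, ((w e : unitInterval) : ℝ) ≠ 0 → e ∈ (↑E : Set (Sym2 V)))
    (f : Sym2 V) (hfe : f ≠ s(x, y)) :
    (rcMeasureW w q ∅).real ({ω | s(x, y) ∈ ω} ∩ {ω | f ∈ ω}) ≤
      (rcMeasureW w q ∅).real {ω | s(x, y) ∈ ω} * (rcMeasureW w q ∅).real {ω | f ∈ ω} := by
  rcases hq1.lt_or_eq with hlt | heq
  · exact edgeNegCorr_of_isTTSP hq0 hlt hE w hw f hfe
  · subst heq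
    rw [rcMeasureW_one]
    have hdet : ∀ g : Sym2 V, DeterminedBy ({ω | g ∈ ω} : Set (BondConfig V)) (↑({g} : Finset (Sym2 V)) : Set (Sym2 V)) := by
      intro g
      rw [determinedBy_iff]
      intro ω ω' h
      rw [Finset.coe_singleton] at h
      constructor
      · intro hg
        have : g ∈ ω' ∩ {g} := h ▸ ⟨hg, rfl⟩
        exact this.1
      · intro hg
        have : g ∈ ω ∩ {g} := h.symm ▸ ⟨hg, rfl⟩
        exact this.1
    rw [prodBernoulli_real_inter_of_determinedBy_disjoint w (Finset.disjoint_singleton.2 hfe.symm) (hdet s(x, y)) (hdet f)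
      (measurableSet_mem _) (measurableSet_mem _)]

/-! ### Building networks: reversal, the terminal edge, paths of length two -/

section Networks

variable {E : Finset (Sym2 V)} {s t : V}

omit [Fintype V] in
/-- Reversing the terminals of a two-terminal series–parallel network. [folklore] -/
theorem IsTTSP.symm (h : IsTTSP E s t) : IsTTSP E t s := by
  induction h with
  | @edge s t hst =>
    have he : ({s(s, t)} : Finset (Sym2 V)) = {s(t, s)} := by rw [Sym2.eq_swap]
    rw [he]
    exact IsTTSP.edge hst.symm
  | @series E₁ E₂ a m b _ _ hd hV ha hb ih₁ ih₂ =>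
    rw [Finset.union_comm]
    exact IsTTSP.series ih₂ ih₁ hd.symm (fun z hz₂ hz₁ => hV z hz₁ hz₂) hb ha
  | @parallel E₁ E₂ s t _ _ hd hV ih₁ ih₂ =>
    exact IsTTSP.parallel ih₁ ih₂ hd (fun z hz₁ hz₂ => (hV z hz₁ hz₂).symm)

omit [Fintype V] in
/-- **Adding the terminal edge**: if `E` is a two-terminal series–parallel network between `s` and `t` not containing the pair `st`,
so is `E ∪ {st}` (parallel composition with the single edge) — e.g. a 2-connected series–parallel graph `G` is `xy ∥ (G ∖ xy)` for
each of its edges `xy` (Duffin 1965). [folklore] -/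
theorem IsTTSP.insert_edge (h : IsTTSP E s t) (he : s(s, t) ∉ E) : IsTTSP (insert s(s, t) E) s t := by
  rw [Finset.insert_eq]
  refine IsTTSP.parallel (IsTTSP.edge h.ne) h (Finset.disjoint_singleton_left.2 he) fun z hz₁ _ => ?_
  obtain ⟨e, he', hze⟩ := hz₁
  rw [Finset.mem_singleton] at he'
  subst he'
  exact Sym2.mem_iff.1 hze

omit [Fintype V] in
/-- **The path of length two** `a – m – b` (`a, m, b` pairwise distinct) is a two-terminal series–parallel network between `a` and
`b` (series composition of two single edges). [folklore] -/
theorem IsTTSP.path₂ {a m b : V} (ham : a ≠ m) (hmb : m ≠ b) (hab : a ≠ b) : IsTTSP ({s(a, m)} ∪ {s(m, b)}) a b := by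
  refine IsTTSP.series (IsTTSP.edge ham) (IsTTSP.edge hmb) ?_ (fun z hz₁ hz₂ => ?_) (fun e he => ?_) (fun e he => ?_)
  · rw [Finset.disjoint_singleton_left, Finset.mem_singleton]
    intro h
    rcases Sym2.eq_iff.1 h with ⟨h1, _⟩ | ⟨h1, _⟩
    · exact ham h1
    · exact hab h1
  · obtain ⟨e₁, he₁, hz₁⟩ := hz₁
    obtain ⟨e₂, he₂, hz₂⟩ := hz₂
    rw [Finset.mem_singleton] at he₁ he₂
    subst he₁; subst he₂
    rcases Sym2.mem_iff.1 hz₁ with rfl | rfl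
    · rcases Sym2.mem_iff.1 hz₂ with h | h
      · exact absurd h ham
      · exact absurd h hab
    · rfl
  · rw [Finset.mem_singleton] at he; subst he
    intro h
    rcases Sym2.mem_iff.1 h with h | h
    · exact ham h
    · exact hab h
  · rw [Finset.mem_singleton] at he; subst he
    intro h
    rcases Sym2.mem_iff.1 h with h | h
    · exact hab h.symm
    · exact hmb h.symm

omit [Fintype V] in
/-- **The triangle** `{ab, am, mb}` is a two-terminal series–parallel network between `a` and `b` (`ab ∥ (am ∘ mb)`); with
`FK.edgeNegCorr_of_isTTSP` this gives, e.g., negative correlation of `ab` with each other pair on every weighted triangle for every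
`q ∈ (0,1)` — a non-vacuity check of the class. [folklore] -/
theorem IsTTSP.triangle {a m b : V} (ham : a ≠ m) (hmb : m ≠ b) (hab : a ≠ b) :
    IsTTSP (insert s(a, b) ({s(a, m)} ∪ {s(m, b)})) a b := by
  refine (IsTTSP.path₂ ham hmb hab).insert_edge fun h => ?_
  rcases Finset.mem_union.1 h with h | h <;> rw [Finset.mem_singleton] at h
  · rcases Sym2.eq_iff.1 h with ⟨_, h2⟩ | ⟨h1, _⟩
    · exact hmb h2.symm
    · exact ham h1
  · rcases Sym2.eq_iff.1 h with ⟨h1, _⟩ | ⟨h1, _⟩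
    · exact ham h1
    · exact hab h1

end Networks

end FK

end Summit.CriticalPhenomena.PercolationContinuityZ3.Theorems

end
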